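import Literature.NumberTheory.EllipticCurves.SkinnerUrban2014.PAdicUnitPeriodRatioAnyPrimeProofs
import Literature.NumberTheory.EllipticCurves.ManinConstantSemistablePrimewise
import Literature.NumberTheory.EllipticCurves.Zhai2021.TwoAdicLowerBoundTwists
import HarnessLib

/-!
# Triage probe (crux-triage r1 seat 1, GEN 6) — item 19577 `OrdMissingLowerBoundAtTwo`, card #8
# `odd-point-shimura-descent-two`, Sketch v3 §3 stub **S1 `OptimalPeriodUnitAtTwo`** (VERBATIM copy below):
# CLOSED modulo the single PRINT binder `abbesUllmo_not_dvd_maninConstant_of_not_dvd_level`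
# (Abbes–Ullmo 1996 Thm. A, `p = 2 ∤ N`), by the tree's
# `ModularParametrizationData.realPeriodRat_eq_abs_mul_plusPeriod_of_latticeEq` (Ω(W₀) = |c₀|·Ω⁺_f exactly for a
# lattice-optimal datum) and `IsNewform0.plusPeriod_pos_holds`; the unit is `u = |c₀| ∈ ℤ`, odd.
# Nothing is asserted; BSD is not proved; 19577 is not closed by this.
-/

set_option autoImplicit false
set_option linter.dupNamespace false

noncomputable section

open scoped Classical MatrixGroups ModularForm

open CongruenceSubgroup WeierstrassCurve Literature.NumberTheory.EllipticCurves
  Literature.NumberTheory.EllipticCurves.ModularForms Literature.NumberTheory.EllipticCurves.Zhai2021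

namespace Summit.BirchSwinnertonDyer.BirchSwinnertonDyer.Cruxes.OrdMissingLowerBoundAtTwo.TriageR1Seat1Gen6

/-- VERBATIM copy of Sketch v3 §3 `OddPointShimuraDescentTwo.OptimalPeriodUnitAtTwo` (l.327–330). -/
def OptimalPeriodUnitAtTwo : Prop :=
  ∀ (W : WeierstrassCurve ℚ) [W.IsElliptic] [W.IsGloballyMinimal] [NeZero (W.conductorNorm ℤ)]
    (D : ModularParametrizationData W (W.conductorNorm ℤ)), IsOptimalDatum W D → Odd (W.conductorNorm ℤ) →
    plusPeriod D.f ≠ 0 ∧ ∃ u : ℚ, ‖((u : ℚ) : ℚ_[2])‖ = 1 ∧ W.realPeriodRat = u * plusPeriod D.f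

/-- **S1 closed modulo Abbes–Ullmo Thm. A (the tree's named print fact).** -/
theorem optimalPeriodUnitAtTwo_of_abbesUllmo (hAU : abbesUllmo_not_dvd_maninConstant_of_not_dvd_level) :
    OptimalPeriodUnitAtTwo := by
  intro W _ _ _ D hD hN
  have hplus : 0 < plusPeriod D.f :=
    IsNewform0.plusPeriod_pos_holds D.isNewformOf.1 D.isNewformOf.coeffField_eq_bot
  refine ⟨hplus.ne', ((|D.c| : ℤ) : ℚ), ?_, ?_⟩
  · -- `2 ∤ c₀` (Abbes–Ullmo at `p = 2 ∤ N`), hence `‖|c₀|‖₂ = 1`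
    have h2 : ¬ ((2 : ℕ) : ℤ) ∣ D.maninConstant := hAU W D hD 2 Nat.prime_two hN.not_two_dvd_nat
    have h2' : ¬ ((2 : ℕ) : ℤ) ∣ |D.c| := by
      rw [dvd_abs]; exact h2
    have hle : ‖((|D.c| : ℤ) : ℚ_[2])‖ ≤ 1 := Padic.norm_int_le_one _
    have hnlt : ¬ ‖((|D.c| : ℤ) : ℚ_[2])‖ < 1 := by
      rw [Padic.norm_intCast_lt_one_iff]; exact h2'
    have h1 : ‖((|D.c| : ℤ) : ℚ_[2])‖ = 1 := le_antisymm hle (not_lt.mp hnlt)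
    rw [Rat.cast_intCast]
    exact h1
  · rw [D.realPeriodRat_eq_abs_mul_plusPeriod_of_latticeEq hD]
    push_cast
    rfl

end Summit.BirchSwinnertonDyer.BirchSwinnertonDyer.Cruxes.OrdMissingLowerBoundAtTwo.TriageR1Seat1Gen6

end
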